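import Literature.Computability.AlgebraicComplexity.MoreAsymmetricCompatCount
import Literature.Computability.AlgebraicComplexity.GlobalStageCompatProduct
import HarnessLib

/-!
# The number of `Y`-compatible level-1 `Y`-blocks is a product over the classes of Claim 5.18
(Alman–Duan–Vassilevska Williams–Xu–Xu–Zhou 2025, Claim 5.17, proof: "`{S_{i,j,0}}_{i,j} ∪ {S_{*,j,+}}_j`
is a partition of `[A₁n]` … by combining each set of possibilities from each part") — proved

Topic `Literature/Computability/AlgebraicComplexity`.  Claim 5.17 of Alman–Duan–Vassilevska Williams–
Xu–Xu–Zhou, *More asymmetry yields faster matrix multiplication* (SODA 2025, arXiv:2404.16349) computes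
`p_compY` from the count `Q` of the level-1 blocks `Y_Ĵ ∈ Y_J` that are `Y`-compatible with a fixed
`α`-consistent triple `X_I Y_J Z_K`: "Fix some `X_I Y_J Z_K` that is consistent with `α`,
`{S_{i,j,0}}_{i,j} ∪ {S_{*,j,+}}_j` is a partition of `[A₁n]`, and we can consider the possibilities of `Ĵ`
on each of these parts.  For `S_{i,j,0}`, the number of possibilities of `Ĵ` is
`2^{H(β_{Y,i,j,0}) · α(i,j,0) · A₁n ± o(n)}` … For `S_{*,j,+}`, the number of possibilities of `Ĵ` is
`2^{H(β̄_{Y,*,j,+}) · α(*,j,+) · A₁n ± o(n)}` … The total number of possible `Ĵ` for a fixed triple is thus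
`2^{(∑_{i,j,k: k=0} H(β_{Y,i,j,0}) α(i,j,0) + ∑_j H(β̄_{Y,*,j,+}) α(*,j,+)) A₁n ± o(n)} = 2^{η_Y A₁ n ± o(n)}`."
This file PROVES the exact form — the `Y`-dimension twin of `GlobalStageCompatProduct.lean` (VXXZ
Claim 5.14 / Def. 5.15) — by writing the classes of Claim 5.18 (`advxxz2025_claim518`, `YCompatibility.lean`)
as the terms of a coarse one-level interface datum, so that the landed block counts of
`InterfaceBlockCounts.lean` apply verbatim:

* `coarseYTermMap` — the COARSE class map of a block triple: a position `t` goes to its class `S_{i,j,0}`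
  if `K_t = 0` and to `S_{*,j,+}` otherwise, with parameter list `coarseYTermList`
  (`(j, β_{Y,i,j,0})`, resp. `(j, β̄_{Y,*,j,+})`, written as `X`-data of an interface term);
* `compatCountY_eq_card_levelBlocks_coarseY` — **the `Y`-compatible `Ĵ ∈ Y_J` are exactly the admissible
  sequences of this coarse datum** (Claim 5.18), so `C_Y = |levelBlocksX coarseY 0|` and
  `compatCountY_eq_prod_multinomial`, `compatCountY_le_two_rpow`, `two_rpow_le_mul_compatCountY`:
  `C_Y = ∏_classes binom`, `2^{∑ |S| H} / poly ≤ C_Y ≤ 2^{∑ |S| H}`;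
* `card_termFibre_coarseY` — the class sizes `|S_{i,j,0}| = α(i,j,0) n`, `|S_{*,j,+}| = α(*,j,+) n`, so that
  `∑ |S| H(β_S) = n · η_Y` with
  `η_Y = ∑_{k=0} α(i,j,0) H(β_{Y,i,j,0}) + ∑_j α(*,j,+) H(β̄_{Y,*,j,+})` (the printed exponent);
* `card_typicalPairsY_eq_multinomial` — `#{typical pairs} = binom(n; θ_Y)`.

Everything is proved; the definitions are the coarse class data and `alphaYpos` (`α(*,j,+)`); no named facts.

## References

* J. Alman, R. Duan, V. Vassilevska Williams, Y. Xu, Z. Xu, R. Zhou, *More asymmetry yields faster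
  matrix multiplication*, SODA 2025, arXiv:2404.16349 (held: `paper:arxiv-2404.16349`, chunks
  p0019–p0020): Claim 5.17 (statement, `η_Y`, and proof), Claim 5.18.
  [AlmanDuanVassilevskaWilliamsXuXuZhou2025]
* V. Vassilevska Williams, Y. Xu, Z. Xu, R. Zhou, *New bounds for matrix multiplication: from alpha
  to omega*, SODA 2024, arXiv:2307.07970, Claim 5.14 (proof) and Def. 5.15 (the `Z`-dimension original).
  [VassilevskaWilliamsXuXuZhou2024]
-/

noncomputable section

open scoped BigOperators
open Finset

namespace Literature.Computability.AlgebraicComplexity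

/-! ## The coarse `Y`-classes of Claim 5.18 -/

section CoarseY

variable (c : ℕ) {n : ℕ}

/-- The coarse `Y`-classes: `(some i, j)`, `i + j = 2c`, for the classes `S_{i,j,0}`, and `(none, j)`,
`j ≤ 2c`, for `S_{*,j,+}`. [cite: AlmanDuanVassilevskaWilliamsXuXuZhou2025, Claim 5.17 (proof: the partition {S_{i,j,0}} ∪ {S_{*,j,+}})] -/
def coarseYClasses : Finset (Option ℕ × ℕ) :=
  ((range (2 * c + 1)).image fun i => (some i, 2 * c - i)) ∪ (range (2 * c + 1)).image fun j => (none, j)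

/-- The classes `S_{i,j,0}` belong to the coarse `Y`-classes. [folklore] -/
theorem some_mem_coarseYClasses {i j : ℕ} (h : i + j = 2 * c) : (some i, j) ∈ coarseYClasses c :=
  mem_union_left _ (mem_image.2 ⟨i, mem_range.2 (by omega), by rw [show 2 * c - i = j by omega]⟩)

/-- The classes `S_{*,j,+}` belong to the coarse `Y`-classes. [folklore] -/
theorem none_mem_coarseYClasses {j : ℕ} (hj : j ≤ 2 * c) : (none, j) ∈ coarseYClasses c :=
  mem_union_right _ (mem_image.2 ⟨j, mem_range.2 (Nat.lt_succ_of_le hj), rfl⟩)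

/-- A class `(some i, j)` has `i + j = 2c`. [folklore] -/
theorem add_eq_of_some_mem_coarseYClasses {i j : ℕ} (h : (some i, j) ∈ coarseYClasses c) : i + j = 2 * c := by
  rcases mem_union.1 h with h | h
  · obtain ⟨i', hi', he⟩ := mem_image.1 h
    simp only [Prod.mk.injEq, Option.some.injEq] at he
    obtain ⟨rfl, rfl⟩ := he
    have := mem_range.1 hi'
    omega
  · obtain ⟨j', -, he⟩ := mem_image.1 h
    simp at he

variable {c}

/-- The coarse `Y`-class of a position of a block triple: `S_{I_t, J_t, 0}` if `K_t = 0`, else `S_{*,J_t,+}`.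
[cite: AlmanDuanVassilevskaWilliamsXuXuZhou2025, Claim 5.17 (proof)] -/
def coarseYClassOf (I J K : Fin n → ℕ) (t : Fin n) : Option ℕ × ℕ :=
  if K t = 0 then (some (I t), J t) else (none, J t)

/-- The coarse `Y`-class of a position is a coarse `Y`-class. [folklore] -/
theorem coarseYClassOf_mem {I J K : Fin n → ℕ} (h : IsLevelTriple c I J K) (t : Fin n) :
    coarseYClassOf I J K t ∈ coarseYClasses c := by
  unfold coarseYClassOf
  have := h t
  split_ifs with hk
  · exact some_mem_coarseYClasses c (by omega)
  · exact none_mem_coarseYClasses c (by omega)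

/-- **The coarse `Y`-term map** of a block triple (positions enumerated into `Fin |coarseYClasses c|`).
[cite: AlmanDuanVassilevskaWilliamsXuXuZhou2025, Claim 5.17 (proof)] -/
def coarseYTermMap {I J K : Fin n → ℕ} (h : IsLevelTriple c I J K) : Fin n → Fin (coarseYClasses c).card :=
  fun t => (coarseYClasses c).equivFin ⟨coarseYClassOf I J K t, coarseYClassOf_mem h t⟩

/-- The split distribution attached to a coarse `Y`-class: `β_{Y,i,j,0}` on `S_{i,j,0}`, `β̄_{Y,*,j,+}` on
`S_{*,j,+}`. [cite: AlmanDuanVassilevskaWilliamsXuXuZhou2025, Claim 5.17 (proof) and Claim 5.18] -/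
def coarseYGamma (c : ℕ) (α : ℕ × ℕ × ℕ → ℝ) (γY : ℕ × ℕ × ℕ → (Fin c → Fin 3) → ℝ) :
    Option ℕ × ℕ → (Fin c → Fin 3) → ℝ
  | (some i, j) => γY (i, j, 0)
  | (none, j) => gammaBarYpos c α γY j

/-- **The coarse `Y`-parameter list**: the class with `Y`-level `j` and its split distribution, written as
the `X`-data of an interface term (so that the landed `X`-block counts apply).
[cite: AlmanDuanVassilevskaWilliamsXuXuZhou2025, Claim 5.17 (proof)] -/
def coarseYTermList (c : ℕ) (α : ℕ × ℕ × ℕ → ℝ) (γY : ℕ × ℕ × ℕ → (Fin c → Fin 3) → ℝ) :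
    Fin (coarseYClasses c).card → InterfaceTerm c := fun s =>
  let cl : Option ℕ × ℕ := ((coarseYClasses c).equivFin.symm s).1
  ⟨cl.2, 0, 0, coarseYGamma c α γY cl, coarseYGamma c α γY cl, coarseYGamma c α γY cl⟩

/-- The fibre of the coarse `Y`-term map over a class. [folklore] -/
theorem filter_coarseYTermMap_eq {I J K : Fin n → ℕ} (h : IsLevelTriple c I J K) (s : Fin (coarseYClasses c).card) :
    (univ.filter fun t => coarseYTermMap h t = s) =
      univ.filter fun t => coarseYClassOf I J K t = ((coarseYClasses c).equivFin.symm s).1 := by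
  ext t
  simp only [mem_filter, mem_univ, true_and, coarseYTermMap]
  rw [Equiv.apply_eq_iff_eq_symm_apply]
  constructor
  · intro ht; exact congrArg Subtype.val ht
  · intro ht; exact Subtype.ext ht

/-- The fibre over `(some i, j)` is the position class `S_{i,j,0}`. [cite: AlmanDuanVassilevskaWilliamsXuXuZhou2025, Claim 5.17 (proof)] -/
theorem filter_coarseYClassOf_some {I J K : Fin n → ℕ} {i j : ℕ} :
    (univ.filter fun t => coarseYClassOf I J K t = (some i, j)) = posClass I J K i j 0 := by
  ext t
  simp only [mem_filter, mem_univ, true_and, mem_posClass, coarseYClassOf]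
  split_ifs with ht
  · simp only [Prod.mk.injEq, Option.some.injEq]
    tauto
  · simp only [Prod.mk.injEq, reduceCtorEq, false_and, false_iff, not_and]
    intro _ _ hk
    exact ht hk

/-- The fibre over `(none, j)` is `S_{*,j,+}`. [cite: AlmanDuanVassilevskaWilliamsXuXuZhou2025, Claim 5.18 (S_{*,j,+})] -/
theorem filter_coarseYClassOf_none {I J K : Fin n → ℕ} {j : ℕ} :
    (univ.filter fun t => coarseYClassOf I J K t = (none, j)) = posClassYpos J K j := by
  ext t
  simp only [mem_filter, mem_univ, true_and, mem_posClassYpos, coarseYClassOf]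
  split_ifs with ht
  · simp only [Prod.mk.injEq, reduceCtorEq, false_and, false_iff, not_and]
    intro _
    omega
  · simp only [Prod.mk.injEq, true_and]
    constructor
    · intro hj; exact ⟨hj, Nat.pos_of_ne_zero ht⟩
    · intro hj; exact hj.1

/-- **The `Y`-compatible level-1 `Y`-blocks in `Y_J` are the admissible sequences of the coarse `Y`-datum**
(in the form of Claim 5.18). [cite: AlmanDuanVassilevskaWilliamsXuXuZhou2025, Claim 5.18 and Claim 5.17 (proof)] -/
theorem mem_levelBlocksX_coarseY_iff {α : ℕ × ℕ × ℕ → ℝ} {γY : ℕ × ℕ × ℕ → (Fin c → Fin 3) → ℝ}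
    {I J K : Fin n → ℕ} (h : IsLevelTriple c I J K) (Jh : Fin n → Fin c → Fin 3) :
    Jh ∈ levelBlocksX (coarseYTermMap h) (coarseYTermList c α γY) 0 ↔
      chunkLevels Jh = J ∧
        ((∀ i j k, k = 0 → (posClass I J K i j k).Nonempty → completeSplitOn Jh (posClass I J K i j k) = γY (i, j, k)) ∧
          ∀ j, (posClassYpos J K j).Nonempty → completeSplitOn Jh (posClassYpos J K j) = gammaBarYpos c α γY j) := by
  rw [levelBlocksX, mem_admissibleSeqs]
  refine and_congr ?_ ?_
  · -- levels: the `Y`-level of the class of `t` is `J t`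
    simp only [funext_iff, chunkLevels_apply, coarseYTermList, coarseYTermMap, Equiv.symm_apply_apply]
    refine forall_congr' fun t => ?_
    have : (coarseYClassOf I J K t).2 = J t := by
      unfold coarseYClassOf; split_ifs <;> rfl
    rw [this]
  · constructor
    · intro hc
      refine ⟨fun i j k hk hne => ?_, fun j hne => ?_⟩
      · subst hk
        have hmem : (some i, j) ∈ coarseYClasses c := by
          obtain ⟨t, ht⟩ := hne
          rw [mem_posClass] at ht
          refine some_mem_coarseYClasses c ?_
          have := h t
          omega
        have := hc ((coarseYClasses c).equivFin ⟨_, hmem⟩)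
        rw [filter_coarseYTermMap_eq, Equiv.symm_apply_apply, filter_coarseYClassOf_some] at this
        have := this hne
        rw [splitConsistentOn_zero_iff] at this
        simpa [coarseYTermList, coarseYGamma] using this
      · have hmem : (none, j) ∈ coarseYClasses c := by
          obtain ⟨t, ht⟩ := hne
          rw [mem_posClassYpos] at ht
          refine none_mem_coarseYClasses c ?_
          have := h t; omega
        have := hc ((coarseYClasses c).equivFin ⟨_, hmem⟩)
        rw [filter_coarseYTermMap_eq, Equiv.symm_apply_apply, filter_coarseYClassOf_none] at this
        have := this hne
        rw [splitConsistentOn_zero_iff] at this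
        simpa [coarseYTermList, coarseYGamma] using this
    · rintro ⟨h1, h2⟩ s hne
      rw [filter_coarseYTermMap_eq] at hne ⊢
      rw [splitConsistentOn_zero_iff]
      simp only [coarseYTermList]
      generalize hcs : (coarseYClasses c).equivFin.symm s = cs at hne ⊢
      obtain ⟨cl, hcl⟩ := cs
      rcases cl with ⟨_ | i, j⟩
      · rw [filter_coarseYClassOf_none] at hne ⊢
        simpa [coarseYGamma] using h2 j hne
      · rw [filter_coarseYClassOf_some] at hne ⊢
        simpa [coarseYGamma] using h1 i j 0 rfl hne

end CoarseY

/-! ## `C_Y` as a block count of the coarse `Y`-datum, and its product form -/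

section AlphaYpos

/-- **`α(*,j,+) = ∑_{i ≥ 0, k > 0} α(i,j,k)`** (as a sum over `i < 2c − j` with `k = 2c − j − i`).
[cite: AlmanDuanVassilevskaWilliamsXuXuZhou2025, Claim 5.17 (η_Y: "α(*,j,+)")] -/
def alphaYpos (c : ℕ) (α : ℕ × ℕ × ℕ → ℝ) (j : ℕ) : ℝ :=
  ∑ i ∈ range (2 * c - j), α (i, j, 2 * c - j - i)

end AlphaYpos

namespace GlobalStageData

open scoped Classical

variable {c n M : ℕ} {D : GlobalStageData c n M}

/-- **`C_Y(T) = |levelBlocksX (coarse Y-datum of T) 0|`** for an `α`-consistent block triple `T` (Claim 5.18 is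
equivalent to `Y`-compatibility, `advxxz2025_claim518`). [cite: AlmanDuanVassilevskaWilliamsXuXuZhou2025, Claim 5.17 (proof) and Claim 5.18] -/
theorem compatCountY_eq_card_levelBlocks_coarseY (hD : D.WellFormed)
    {T : (Fin n → Fin (2 * c + 1)) × (Fin n → Fin (2 * c + 1)) × (Fin n → Fin (2 * c + 1))} (hT : T ∈ D.𝒯α) :
    D.compatCountY T = (levelBlocksX (coarseYTermMap (isLevelTriple_of_mem_tripleSet (hD.subset hT)))
      (coarseYTermList c D.α D.γY) 0).card := by
  have hlev := isLevelTriple_of_mem_tripleSet (hD.subset hT)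
  have hα := hD.alphaConsistent T hT
  unfold compatCountY
  congr 1
  ext Jh
  rw [mem_filter, mem_levelBlocksX_coarseY_iff, ← advxxz2025_claim518 hlev hα, chunkLevels_eq_iff]
  simp [YCompatible]

/-- **`C_Y = ∏_{classes} binom(|S|; k_S)`** for integral class types `k_S = |S| · β_S` supported on chunk
shapes of the class level. [cite: AlmanDuanVassilevskaWilliamsXuXuZhou2025, Claim 5.17 (proof: "by combining each set of possibilities from each part")] -/
theorem compatCountY_eq_prod_multinomial (hD : D.WellFormed)
    {T : (Fin n → Fin (2 * c + 1)) × (Fin n → Fin (2 * c + 1)) × (Fin n → Fin (2 * c + 1))} (hT : T ∈ D.𝒯α)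
    (k : Fin (coarseYClasses c).card → (Fin c → Fin 3) → ℕ)
    (hk : ∀ s σ, (k s σ : ℝ) = (termFibre (coarseYTermMap (isLevelTriple_of_mem_tripleSet (hD.subset hT))) s).card *
      (coarseYTermList c D.α D.γY s).γX σ)
    (hsupp : ∀ s σ, k s σ ≠ 0 → patternLevel σ = (coarseYTermList c D.α D.γY s).i)
    (hsum : ∀ s, ∑ σ, k s σ = (termFibre (coarseYTermMap (isLevelTriple_of_mem_tripleSet (hD.subset hT))) s).card) :
    D.compatCountY T = ∏ s, Nat.multinomial univ (k s) := by
  rw [compatCountY_eq_card_levelBlocks_coarseY hD hT]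
  exact card_levelBlocksX_zero_eq_prod_multinomial _ _ k hk hsupp hsum

/-- **`C_Y ≤ 2^{∑_S |S| H(k_S/|S|)}`** (Lemma 3.3, upper half). [cite: AlmanDuanVassilevskaWilliamsXuXuZhou2025, Claim 5.17 (proof: "2^{H(β)·α·A₁n ± o(n)}")] -/
theorem compatCountY_le_two_rpow (hD : D.WellFormed)
    {T : (Fin n → Fin (2 * c + 1)) × (Fin n → Fin (2 * c + 1)) × (Fin n → Fin (2 * c + 1))} (hT : T ∈ D.𝒯α)
    (k : Fin (coarseYClasses c).card → (Fin c → Fin 3) → ℕ)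
    (hk : ∀ s σ, (k s σ : ℝ) = (termFibre (coarseYTermMap (isLevelTriple_of_mem_tripleSet (hD.subset hT))) s).card *
      (coarseYTermList c D.α D.γY s).γX σ)
    (hsupp : ∀ s σ, k s σ ≠ 0 → patternLevel σ = (coarseYTermList c D.α D.γY s).i)
    (hsum : ∀ s, ∑ σ, k s σ = (termFibre (coarseYTermMap (isLevelTriple_of_mem_tripleSet (hD.subset hT))) s).card) :
    (D.compatCountY T : ℝ) ≤ 2 ^ (∑ s, ((termFibre (coarseYTermMap (isLevelTriple_of_mem_tripleSet (hD.subset hT))) s).card : ℝ) *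
      shannonEntropy (fun σ => (k s σ : ℝ) / (termFibre (coarseYTermMap (isLevelTriple_of_mem_tripleSet (hD.subset hT))) s).card)) := by
  rw [compatCountY_eq_card_levelBlocks_coarseY hD hT]
  exact card_levelBlocksX_zero_le_two_rpow _ _ k hk hsupp hsum

/-- **`2^{∑_S |S| H(k_S/|S|)} ≤ (∏_S (|S|+1)^{3^c}) · C_Y`** (Lemma 3.3, lower half; the polynomial loss is
`2^{o(n)}`). [cite: AlmanDuanVassilevskaWilliamsXuXuZhou2025, Claim 5.17 (proof)] -/
theorem two_rpow_le_mul_compatCountY (hD : D.WellFormed)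
    {T : (Fin n → Fin (2 * c + 1)) × (Fin n → Fin (2 * c + 1)) × (Fin n → Fin (2 * c + 1))} (hT : T ∈ D.𝒯α)
    (k : Fin (coarseYClasses c).card → (Fin c → Fin 3) → ℕ)
    (hk : ∀ s σ, (k s σ : ℝ) = (termFibre (coarseYTermMap (isLevelTriple_of_mem_tripleSet (hD.subset hT))) s).card *
      (coarseYTermList c D.α D.γY s).γX σ)
    (hsupp : ∀ s σ, k s σ ≠ 0 → patternLevel σ = (coarseYTermList c D.α D.γY s).i)
    (hsum : ∀ s, ∑ σ, k s σ = (termFibre (coarseYTermMap (isLevelTriple_of_mem_tripleSet (hD.subset hT))) s).card) :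
    (2 : ℝ) ^ (∑ s, ((termFibre (coarseYTermMap (isLevelTriple_of_mem_tripleSet (hD.subset hT))) s).card : ℝ) *
      shannonEntropy (fun σ => (k s σ : ℝ) / (termFibre (coarseYTermMap (isLevelTriple_of_mem_tripleSet (hD.subset hT))) s).card)) ≤
      (∏ s, (((termFibre (coarseYTermMap (isLevelTriple_of_mem_tripleSet (hD.subset hT))) s).card + 1 : ℝ)) ^ (3 ^ c)) *
        D.compatCountY T := by
  rw [compatCountY_eq_card_levelBlocks_coarseY hD hT]
  exact two_rpow_le_mul_card_levelBlocksX_zero _ _ k hk hsupp hsum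

/-- **The class sizes**: `|S_{i,j,0}| = α(i,j,0) n` and `|S_{*,j,+}| = α(*,j,+) n`, so that
`∑_S |S| H(β_S) = n · η_Y` (the printed exponent). [cite: AlmanDuanVassilevskaWilliamsXuXuZhou2025, Claim 5.17 (η_Y and proof)] -/
theorem card_termFibre_coarseY (hD : D.WellFormed)
    {T : (Fin n → Fin (2 * c + 1)) × (Fin n → Fin (2 * c + 1)) × (Fin n → Fin (2 * c + 1))} (hT : T ∈ D.𝒯α)
    (s : Fin (coarseYClasses c).card) :
    ((termFibre (coarseYTermMap (isLevelTriple_of_mem_tripleSet (hD.subset hT))) s).card : ℝ) =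
      (match ((coarseYClasses c).equivFin.symm s).1 with
        | (some i, j) => D.α (i, j, 0)
        | (none, j) => alphaYpos c D.α j) * n := by
  have hlev := isLevelTriple_of_mem_tripleSet (hD.subset hT)
  have hα := hD.alphaConsistent T hT
  dsimp only [termFibre]
  rw [filter_coarseYTermMap_eq]
  generalize hcs : (coarseYClasses c).equivFin.symm s = cs
  obtain ⟨cl, hcl⟩ := cs
  rcases cl with ⟨_ | i, j⟩
  · simp only
    rw [filter_coarseYClassOf_none, alphaYpos]
    exact card_posClassYpos_eq_alpha_mul hlev hα j
  · simp only
    rw [filter_coarseYClassOf_some]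
    exact hα i j 0

/-- **`#{typical Y-pairs} = binom(n; θ_Y)`**, `θ_Y` the joint type of any typical pair (the printed count
"the total number of typical `Y_Ĵ` … is `2^{H(β̄_{Y,*,*,*}) · A₁ n ± o(n)}`" before taking entropies).
[cite: AlmanDuanVassilevskaWilliamsXuXuZhou2025, Claim 5.17 (proof, quantity P)] -/
theorem card_typicalPairsY_eq_multinomial {p₀ : (Fin n → Fin (2 * c + 1)) × (Fin n → Fin c → Fin 3)}
    (hp₀ : p₀ ∈ D.typicalPairsY) :
    D.typicalPairsY.card = Nat.multinomial univ (letterCount (pairSeq p₀.1 p₀.2)) := by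
  rw [card_typicalPairsY_eq hp₀, card_typeClass_eq_multinomial n _ (sum_letterCount _)]

end GlobalStageData

end Literature.Computability.AlgebraicComplexity
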